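import Literature.NumberTheory.Transcendental.KZVolumeConjectureProofs
import Literature.NumberTheory.Transcendental.KZKernelConjectureForms
import Literature.NumberTheory.Transcendental.KZCalculusProofs
import Summits.KontsevichZagierPeriods.KontsevichZagierPeriods.Statement
import HarnessLib

/-!
# SoloInformed — the volume ladder of the Kontsevich–Zagier conjecture

The summit `KontsevichZagierPeriods` (KZ 2001, §1.2, Conjecture 1) is equivalent to the volume form
of Cresson–Viu-Sos (`KZ.volumeConjectureCompact`, via Viu-Sos' semi-canonical reduction, both in
the tree). This file grades the volume form by the ambient dimension `d` of the two compact
top-dimensional `ℚ`-semialgebraic sets: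

* `SoloInformedVolumeRung d` — "two compact `ℚ`-semialgebraic subsets of `ℝᵈ` with non-empty
  interior and the same `d`-volume are connected by the KZ moves";
* `soloInformed_volumeConjectureCompact_iff` — the volume form is the conjunction of all rungs;
* `soloInformed_kontsevichZagierPeriods_iff_forall_rung` — so is the summit;
* `soloInformedVolumeRung_mono` — **the rungs are nested**: rung `d + 1` implies rung `d`
  (stabilise both sets by the unit slab `K × [0, 1]`, one Newton–Leibniz move each,
  `KZ.IntegralRep.equivalent_slab`), hence `soloInformedVolumeRung_of_le` and
  `soloInformed_kontsevichZagierPeriods_iff_frequently` (the summit is equivalent to the rungs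
  holding for arbitrarily large `d`).

Why this grading (solo residency `solo-KontsevichZagierPeriods-informed`, PLAN.md): the `d`-volumes of
`ℚ`-semialgebraic sets are periods of weight `≤ d − 1`; rung `1` is elementary (lengths are real
algebraic numbers), rung `2` (areas of planar regions = periods of curves) is the last rung for
which the needed transcendence input exists in print (Huber–Wüstholz 2022, Thm. 13.3: all
`ℚ̄`-linear relations between 1-periods are induced by bilinearity and functoriality of pairs of
curves), and rung `3` already contains `log 2 · log 3`, `ζ(2)`-type and dilogarithm volumes for
which no transcendence theory is available.

References: M. Kontsevich, D. Zagier, *Periods* (2001), §1.2; J. Cresson, J. Viu-Sos, JTNB 34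
(2022), §1; J. Viu-Sos, IJNT 17 (2021), Thm. 1.1; A. Huber, G. Wüstholz, *Transcendence and linear
relations of 1-periods*, CUP 2022, Thm. 13.3.
-/

noncomputable section

open Set MeasureTheory

open Literature.NumberTheory.Transcendental

namespace Summit.KontsevichZagierPeriods.KontsevichZagierPeriods.Theorems

/-- **Rung `d` of the volume ladder.** Any two integrand-`1` representations on compact
`ℚ`-semialgebraic domains of `ℝᵈ` with non-empty interior and equal value (= equal `d`-volume) are
KZ-equivalent. The volume conjecture `KZ.volumeConjectureCompact` is `∀ d, SoloInformedVolumeRung d`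
(`soloInformed_volumeConjectureCompact_iff`); this is its restriction to one ambient dimension.
[Cresson–Viu-Sos 2022, §1 p. 326, Conjecture, graded by dimension]
[cite: CressonViusos2022, §1 p. 326 Conjecture] -/
def SoloInformedVolumeRung (d : ℕ) : Prop :=
  ∀ (r r' : KZ.IntegralRep d),
    IsCompact r.domain → (interior r.domain).Nonempty →
    IsCompact r'.domain → (interior r'.domain).Nonempty →
    (∀ x ∈ r.domain, r.integrand x = 1) → (∀ x ∈ r'.domain, r'.integrand x = 1) →
    r.value = r'.value → KZ.Equivalent r r'

/-- The volume form of Conjecture 1 is the conjunction of the rungs. [folklore] -/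
theorem soloInformed_volumeConjectureCompact_iff :
    KZ.volumeConjectureCompact ↔ ∀ d, SoloInformedVolumeRung d :=
  ⟨fun h _ r r' => h r r', fun h _ r r' => h _ r r'⟩

/-- **The summit is the conjunction of the rungs**: `KontsevichZagierPeriods ↔ ∀ d, rung d`
(summit = `IsRational` two-representation form `↔ KZPeriodConjecture'`
(`kzPeriodConjecture'_iff_isRational`) `↔ volumeConjectureCompact`
(`KZ.kzPeriodConjecture'_iff_volumeConjectureCompact_holds`, Viu-Sos/Cresson–Viu-Sos)).
[Cresson–Viu-Sos 2022, §1 p. 326] -/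
theorem soloInformed_kontsevichZagierPeriods_iff_forall_rung :
    KontsevichZagierPeriods ↔ ∀ d, SoloInformedVolumeRung d := by
  have h₁ : KZPeriodConjecture' ↔ KZ.volumeConjectureCompact :=
    KZ.kzPeriodConjecture'_iff_volumeConjectureCompact_holds
  rw [← soloInformed_volumeConjectureCompact_iff, ← h₁, KontsevichZagierPeriods_iff,
    kzPeriodConjecture'_iff_isRational]

/-! ### The rungs are nested -/

namespace SoloInformed

variable {n : ℕ} (r : KZ.IntegralRep n) (j : ℕ)

/-- The slab `σ × [j, j+1]` is the image of `σ ×ˢ [j, j+1]` under `(x, t) ↦ Fin.snoc x t`.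
[folklore] -/
theorem slabDomain_eq_image :
    r.slabDomain j =
      (fun p : (Fin n → ℝ) × ℝ => (Fin.snoc p.1 p.2 : Fin (n + 1) → ℝ)) ''
        (r.domain ×ˢ Icc (j : ℝ) (j + 1)) := by
  ext z
  constructor
  · intro hz
    refine ⟨(Fin.init z, z (Fin.last n)), ?_, Fin.snoc_init_self z⟩
    rw [← Fin.snoc_init_self z, KZ.IntegralRep.snoc_mem_slabDomain] at hz
    simpa [mem_prod] using hz
  · rintro ⟨p, hp, rfl⟩
    rw [KZ.IntegralRep.snoc_mem_slabDomain]
    simpa [mem_prod] using hp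

/-- `(x, t) ↦ Fin.snoc x t` is continuous. [folklore] -/
theorem continuous_snoc_prod :
    Continuous (fun p : (Fin n → ℝ) × ℝ => (Fin.snoc p.1 p.2 : Fin (n + 1) → ℝ)) :=
  Continuous.finSnoc (A := fun _ : Fin (n + 1) => ℝ) continuous_fst continuous_snd

/-- `Fin.init` is continuous. [folklore] -/
theorem continuous_init : Continuous (Fin.init : (Fin (n + 1) → ℝ) → (Fin n → ℝ)) :=
  continuous_pi fun _ => continuous_apply _

/-- The unit slab over a compact domain is compact. [folklore] -/
theorem isCompact_slabDomain (hr : IsCompact r.domain) : IsCompact (r.slabDomain j) := by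
  rw [slabDomain_eq_image]
  exact (hr.prod isCompact_Icc).image continuous_snoc_prod

/-- The unit slab over a domain with non-empty interior has non-empty interior: it contains the
open set `init ⁻¹' (interior σ) ∩ {j < z_last < j + 1}`. [folklore] -/
theorem interior_slabDomain_nonempty (hr : (interior r.domain).Nonempty) :
    (interior (r.slabDomain j)).Nonempty := by
  obtain ⟨x, hx⟩ := hr
  refine ⟨Fin.snoc x ((j : ℝ) + 1 / 2), mem_interior.mpr ⟨
    Fin.init ⁻¹' interior r.domain ∩ (fun z => z (Fin.last n)) ⁻¹' Ioo (j : ℝ) (j + 1),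
    ?_, ?_, ?_⟩⟩
  · rintro z ⟨hz₁, hz₂⟩
    rw [mem_preimage] at hz₁ hz₂
    exact ⟨interior_subset hz₁, hz₂.1.le, hz₂.2.le⟩
  · exact (isOpen_interior.preimage continuous_init).inter
      (isOpen_Ioo.preimage (continuous_apply _))
  · refine ⟨?_, ?_⟩
    · rw [mem_preimage, Fin.init_snoc]; exact hx
    · rw [mem_preimage, Fin.snoc_last]; constructor <;> linarith

/-- The slab representation has integrand `1` on its domain when `r` has. [folklore] -/
theorem integrand_slab_eq_one (h1 : ∀ x ∈ r.domain, r.integrand x = 1) :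
    ∀ z ∈ (r.slab j).domain, (r.slab j).integrand z = 1 := by
  intro z hz
  rw [KZ.IntegralRep.domain_slab] at hz
  simp only [KZ.IntegralRep.integrand_slab]
  exact h1 _ hz.1

end SoloInformed

/-- **The rungs are nested**: rung `d + 1` implies rung `d`. Stabilise both compact sets by the
unit slab (`K ↦ K × [0, 1]`, a single Newton–Leibniz move, `KZ.IntegralRep.equivalent_slab`);
the slabs are compact with non-empty interior, integrand `1` and the same `(d+1)`-volume, so rung
`d + 1` connects them. [folklore] -/
theorem soloInformedVolumeRung_mono {d : ℕ} (h : SoloInformedVolumeRung (d + 1)) :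
    SoloInformedVolumeRung d := by
  intro r r' hr hri hr' hri' h1 h1' hv
  have e : KZ.Equivalent r (r.slab 0) := KZ.IntegralRep.equivalent_slab r 0
  have e' : KZ.Equivalent r' (r'.slab 0) := KZ.IntegralRep.equivalent_slab r' 0
  have hv' : (r.slab 0).value = (r'.slab 0).value := by
    rw [← KZ.Equivalent.value_eq_holds e, ← KZ.Equivalent.value_eq_holds e', hv]
  have key : KZ.Equivalent (r.slab 0) (r'.slab 0) :=
    h _ _ (SoloInformed.isCompact_slabDomain r 0 hr)
      (SoloInformed.interior_slabDomain_nonempty r 0 hri)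
      (SoloInformed.isCompact_slabDomain r' 0 hr')
      (SoloInformed.interior_slabDomain_nonempty r' 0 hri')
      (SoloInformed.integrand_slab_eq_one r 0 h1) (SoloInformed.integrand_slab_eq_one r' 0 h1') hv'
  exact (e.trans key).trans e'.symm

/-- Rung `d'` implies rung `d` for every `d ≤ d'`. [folklore] -/
theorem soloInformedVolumeRung_of_le {d d' : ℕ} (hle : d ≤ d') (h : SoloInformedVolumeRung d') :
    SoloInformedVolumeRung d := by
  induction hle with
  | refl => exact h
  | step _ ih => exact ih (soloInformedVolumeRung_mono h)

/-- **The summit is equivalent to the rungs holding for arbitrarily large dimension**: any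
cofinal family of rungs gives all of them (nesting), hence the volume form, hence Conjecture 1.
[folklore] -/
theorem soloInformed_kontsevichZagierPeriods_iff_frequently :
    KontsevichZagierPeriods ↔ ∀ d, ∃ d', d ≤ d' ∧ SoloInformedVolumeRung d' := by
  rw [soloInformed_kontsevichZagierPeriods_iff_forall_rung]
  constructor
  · exact fun h d => ⟨d, le_rfl, h d⟩
  · intro h d
    obtain ⟨d', hle, hd'⟩ := h d
    exact soloInformedVolumeRung_of_le hle hd'


end Summit.KontsevichZagierPeriods.KontsevichZagierPeriods.Theorems
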